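import Summits.BirchSwinnertonDyer.BirchSwinnertonDyer.Theorems.ClassRecordThreeCornerTwistWitnessRungs
import HarnessLib

/-!
# Route `ClassRecordThree` (rung K2@3), crux `CornerAtThreeW` (item stmt-BirchSwinnertonDyer-21420), aside
# `CornerTwistWitnessLeafAtThree` (item 21421): BC5 RUNG ROWS 01 for `CornerTwistWitnessAt W` — three t0 rows and two
# Tamagawa-cell rows with an OMS `μ = 0` certificate (cell `bsd-stepL`, seat `bsd-stepL-mult-p3` g5; `--supports stmt-BirchSwinnertonDyer-21421`)

HONEST FRAMING. BSD is not proved by any of this; each rung is ONE curve and closes nothing; `CornerTwistWitnessLeafAtThree` is asserted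
nowhere. THEOREMS ONLY (0 defs, 0 named facts, 0 `sorry`). Same KERNEL ∕ ATTESTED split as `…CornerTwistWitnessRungs` (whose masters
`cornerTwistWitnessAt_of_certifiedTwin` ∕ `…_of_muAn` are instantiated): KERNEL = the field `ℚ(√d)`, `d_K = d` odd `< -4`, both Heegner
hypotheses from the prime factors of the INTEGER `Δ(W)` and Kronecker symbols, the twist identity `Cd • W.quadraticTwist d = Wd`;
ATTESTED = the census row's `L(E^d,1) ≠ 0` and `#Ш_an(E^d)` (D-h census, kit j289339 ∕ j289342 ∕ j289343 ∕ j289345: engines PARI `ellL1`∕`ellbsd`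
at 38 and 77 digits agree on all 296 witness rows; every `#Ш_an` rounds to a perfect square within `2^-109`), for t0 rows `3 ∤ ∏c(E)`, for the
Tamagawa-cell rows the `μ_an = 0` certificate at the twin (kit j289586: twisted overconvergent modular symbols of `E` at level `N`, `p = 3`,
as in the cell's CERT-TWISTMUAN-3 j266708, whose four pairs it reproduces digit for digit), and global minimality of the integer models.
Rows: `19200a1` (t0, Ns), `102966a1` (t0, Ns), `487227a1` (t0, Nn; the largest corner conductor below 5·10⁵), `2535d1` (mono-carrier, Ns),
`3840k1` (multi-carrier, Ns split at 3).

PARTITION: O2@3 (B10) × T4″ corner × crux `CornerAtThreeW` witness conjunct — types-the-object-of (BC5 rungs); closes: none (T7).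

References (locators only): [cite: Miller2011LMS, Def. 1.1 (arXiv:1010.2431 p. 3)] [cite: Kato2004Asterisque, §17.13]
[cite: SteinWuthrich2013, Thm. 6.1] [cite: Wuthrich2014, Cor. 18] [cite: Marcus2018, Ch. 3 Thm. 25 (decomposition law)].
-/

open scoped Classical NumberField

-- the cell's Theorems namespace repeats the summit name (Summit.<Summit>.<Problem>), as in every sibling file
set_option linter.dupNamespace false

namespace Summit.BirchSwinnertonDyer.BirchSwinnertonDyer.Theorems.CornerTwistWitness

open WeierstrassCurve NumberField IsDedekindDomain Field
  Literature.NumberTheory.EllipticCurves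
  Literature.NumberTheory.EllipticCurves.ModularForms
  Literature.NumberTheory.EllipticCurves.Rank1Residual
  Literature.NumberTheory.EllipticCurves.Rank1Residual.Typed
  Literature.NumberTheory.EllipticCurves.Wuthrich2014
  Literature.NumberTheory.EllipticCurves.SteinWuthrich2013
  Literature.NumberTheory.EllipticCurves.Greenberg1999
  Literature.NumberTheory.EllipticCurves.Kato2004
  Literature.NumberTheory.QuadraticFields.Quadratic
  Summit.BirchSwinnertonDyer.Rank1Residual
  Summit.BirchSwinnertonDyer.Rank1Residual.X11b
  Summit.BirchSwinnertonDyer.Rank1Residual.X11b.Three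

/-- **BC5 rung at Cremona `19200a1`** (N = 19200 = 2^8 · 3 · 5^2; image type `Ns` at `3`; t0 cell `3 ∤ ∏c = 8`):
the EXACT odd Heegner twin `d = -71` — census row (kit j289043): `#Ш_an(E^d) = 1`, `∏_ℓ c_ℓ(E^d) = 32`,
`#E^d(ℚ)_tors = 2`, `L(E^d,1)/Ω⁺ = 8` (engines 1 ∕ 2a agree). KERNEL: `Δ(W) = 729000000000` (primes 2, 3, 5),
the Kronecker symbols `(-71/p) = 1` at those primes and at `3`, `d ≡ 1 (mod 4)` squarefree, the field `ℚ(√-71)`, and the twist identity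
`Cd • W.quadraticTwist -71 = Wd` with `Cd = (u,r,s,t) = (1,-24,0,0)`, `Wd = ⟨0, -1, 0, -39739883, -95283871113⟩` (Tate ∕ PARI `ellminimalmodel`). ATTESTED: `L(E^d,1) ≠ 0`,
`#Ш_an(Wd) = 1`, `3 ∤ ∏c(E)`, global minimality. One curve; closes nothing. [cite: Miller2011LMS, Def. 1.1] -/
theorem cornerTwistWitnessAt_19200a1
    (hF : thm61_splitMultiplicative ∧ thm61_nonsplitMultiplicative ∧
      rank_eq_analyticRank_of_analyticRank_le_one ∧ WeierstrassCurve.hasEntireLFunction_rat ∧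
      nonempty_modularParametrizationData ∧
      (∀ (W : WeierstrassCurve ℚ) [W.IsElliptic] [W.IsGloballyMinimal] (p : ℕ) [Fact p.Prime],
        greenberg_stevens (W := W) (p := p)) ∧
      Kato2004.nonempty_iwasawaH1Data ∧ Kato2004.thm12_4 ∧
      Kato2004.exists_multDivisibilityInputs_nonsplit ∧ Kato2004.exists_multDivisibilityInputs_split ∧
      thm15_isTorsion_multiplicative_rat ∧
      Wuthrich2014.corollary18_padicLFunction_mem_iwasawaAlgebra_multiplicative ∧
      Kato2004.exists_multDivisibilityInputs_fine)
    (W : WeierstrassCurve ℚ) (hW : W = ⟨0, -1, 0, -7883, 268887⟩) [W.IsElliptic] [W.IsGloballyMinimal]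
    (Wd : WeierstrassCurve ℚ) (hWd : Wd = ⟨0, -1, 0, -39739883, -95283871113⟩) [Wd.IsElliptic] [Wd.IsGloballyMinimal]
    (ht0 : ¬ 3 ∣ W.tamagawaProduct)
    (hLt : (W.quadraticTwist ((-71 : ℤ) : ℚ)).entireLFunction 1 ≠ 0) (hsha : shaAn Wd = ((1 : ℕ) : ℂ)) :
    CornerTwistWitnessAt W := by
  obtain ⟨hJs, hJn, hGZK, hmod, hpar, hGS, hne, h12, hns, hsp, h15, h18, hfine⟩ := hF
  exact cornerTwistWitnessAt_of_certifiedTwin hJs hJn hGZK hmod hpar hGS hne h12 hns hsp h15 h18 hfine W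
    (d := -71) (Δ₀ := 729000000000) (by decide) (Int.squarefree_natAbs.mp (by rw [Int.natAbs_neg]; exact (show Squarefree (71 : ℕ) from (by norm_num : Nat.Prime 71).prime.squarefree))) (by decide)
    (by subst hW; norm_num [WeierstrassCurve.Δ, WeierstrassCurve.b₂, WeierstrassCurve.b₄, WeierstrassCurve.b₆,
      WeierstrassCurve.b₈])
    (by
      intro p hp hpd
      have hn : (729000000000 : ℤ).natAbs = 2 ^ 9 * 3 ^ 6 * 5 ^ 9 := by norm_num
      rw [hn] at hpd
      simp only [hp.dvd_mul, hp.prime.dvd_pow_iff_dvd, Nat.prime_dvd_prime_iff_eq hp (show Nat.Prime 2 by norm_num), Nat.prime_dvd_prime_iff_eq hp (show Nat.Prime 3 by norm_num), Nat.prime_dvd_prime_iff_eq hp (show Nat.Prime 5 by norm_num), ne_eq, OfNat.ofNat_ne_zero, not_false_eq_true] at hpd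
      rcases hpd with ((rfl | rfl) | rfl) <;> constructor <;> intro h <;> first | exact absurd h (by decide) | norm_num)
    (by norm_num)
    ht0 Wd ⟨1, (-24 : ℚ), 0, 0⟩
    (by
      subst hW; subst hWd
      ext <;> simp only [variableChange_a₁, variableChange_a₂, variableChange_a₃, variableChange_a₄, variableChange_a₆,
        quadraticTwist_a₁, quadraticTwist_a₂, quadraticTwist_a₃, quadraticTwist_a₄, quadraticTwist_a₆,
        WeierstrassCurve.b₂, WeierstrassCurve.b₄, WeierstrassCurve.b₆] <;> push_cast <;> norm_num)
    (by exact_mod_cast hLt) (shaAn_cert_of_eq_nat Wd (by norm_num) (by norm_num) hsha)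

/-- **BC5 rung at Cremona `102966a1`** (N = 102966 = 2 · 3 · 131^2; image type `Ns` at `3`; t0 cell `3 ∤ ∏c = 2`):
the EXACT odd Heegner twin `d = -23` — census row (kit j289043): `#Ш_an(E^d) = 25`, `∏_ℓ c_ℓ(E^d) = 2`,
`#E^d(ℚ)_tors = 1`, `L(E^d,1)/Ω⁺ = 50` (engines 1 ∕ 2a agree). KERNEL: `Δ(W) = 2454117837359000595336` (primes 2, 3, 131),
the Kronecker symbols `(-23/p) = 1` at those primes and at `3`, `d ≡ 1 (mod 4)` squarefree, the field `ℚ(√-23)`, and the twist identity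
`Cd • W.quadraticTwist -23 = Wd` with `Cd = (u,r,s,t) = (1,10,1/2,0)`, `Wd = ⟨1, 1, 0, -5029494754, -134193036241076⟩` (Tate ∕ PARI `ellminimalmodel`). ATTESTED: `L(E^d,1) ≠ 0`,
`#Ш_an(Wd) = 25`, `3 ∤ ∏c(E)`, global minimality. One curve; closes nothing. [cite: Miller2011LMS, Def. 1.1] -/
theorem cornerTwistWitnessAt_102966a1
    (hF : thm61_splitMultiplicative ∧ thm61_nonsplitMultiplicative ∧
      rank_eq_analyticRank_of_analyticRank_le_one ∧ WeierstrassCurve.hasEntireLFunction_rat ∧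
      nonempty_modularParametrizationData ∧
      (∀ (W : WeierstrassCurve ℚ) [W.IsElliptic] [W.IsGloballyMinimal] (p : ℕ) [Fact p.Prime],
        greenberg_stevens (W := W) (p := p)) ∧
      Kato2004.nonempty_iwasawaH1Data ∧ Kato2004.thm12_4 ∧
      Kato2004.exists_multDivisibilityInputs_nonsplit ∧ Kato2004.exists_multDivisibilityInputs_split ∧
      thm15_isTorsion_multiplicative_rat ∧
      Wuthrich2014.corollary18_padicLFunction_mem_iwasawaAlgebra_multiplicative ∧
      Kato2004.exists_multDivisibilityInputs_fine)
    (W : WeierstrassCurve ℚ) (hW : W = ⟨1, 1, 0, -9507551, 11025128733⟩) [W.IsElliptic] [W.IsGloballyMinimal]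
    (Wd : WeierstrassCurve ℚ) (hWd : Wd = ⟨1, 1, 0, -5029494754, -134193036241076⟩) [Wd.IsElliptic] [Wd.IsGloballyMinimal]
    (ht0 : ¬ 3 ∣ W.tamagawaProduct)
    (hLt : (W.quadraticTwist ((-23 : ℤ) : ℚ)).entireLFunction 1 ≠ 0) (hsha : shaAn Wd = ((25 : ℕ) : ℂ)) :
    CornerTwistWitnessAt W := by
  obtain ⟨hJs, hJn, hGZK, hmod, hpar, hGS, hne, h12, hns, hsp, h15, h18, hfine⟩ := hF
  exact cornerTwistWitnessAt_of_certifiedTwin hJs hJn hGZK hmod hpar hGS hne h12 hns hsp h15 h18 hfine W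
    (d := -23) (Δ₀ := 2454117837359000595336) (by decide) (Int.squarefree_natAbs.mp (by rw [Int.natAbs_neg]; exact (show Squarefree (23 : ℕ) from (by norm_num : Nat.Prime 23).prime.squarefree))) (by decide)
    (by subst hW; norm_num [WeierstrassCurve.Δ, WeierstrassCurve.b₂, WeierstrassCurve.b₄, WeierstrassCurve.b₆,
      WeierstrassCurve.b₈])
    (by
      intro p hp hpd
      have hn : (2454117837359000595336 : ℤ).natAbs = 2 ^ 3 * 3 ^ 3 * 131 ^ 9 := by norm_num
      rw [hn] at hpd
      simp only [hp.dvd_mul, hp.prime.dvd_pow_iff_dvd, Nat.prime_dvd_prime_iff_eq hp (show Nat.Prime 2 by norm_num), Nat.prime_dvd_prime_iff_eq hp (show Nat.Prime 3 by norm_num), Nat.prime_dvd_prime_iff_eq hp (show Nat.Prime 131 by norm_num), ne_eq, OfNat.ofNat_ne_zero, not_false_eq_true] at hpd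
      rcases hpd with ((rfl | rfl) | rfl) <;> constructor <;> intro h <;> first | exact absurd h (by decide) | norm_num)
    (by norm_num)
    ht0 Wd ⟨1, 10, (1/2 : ℚ), 0⟩
    (by
      subst hW; subst hWd
      ext <;> simp only [variableChange_a₁, variableChange_a₂, variableChange_a₃, variableChange_a₄, variableChange_a₆,
        quadraticTwist_a₁, quadraticTwist_a₂, quadraticTwist_a₃, quadraticTwist_a₄, quadraticTwist_a₆,
        WeierstrassCurve.b₂, WeierstrassCurve.b₄, WeierstrassCurve.b₆] <;> push_cast <;> norm_num)
    (by exact_mod_cast hLt) (shaAn_cert_of_eq_nat Wd (by norm_num) (by norm_num) hsha)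

/-- **BC5 rung at Cremona `487227a1`** (N = 487227 = 3 · 13^2 · 31^2; image type `Nn` at `3`; t0 cell `3 ∤ ∏c = 8`):
the EXACT odd Heegner twin `d = -23` — census row (kit j289043): `#Ш_an(E^d) = 1`, `∏_ℓ c_ℓ(E^d) = 16`,
`#E^d(ℚ)_tors = 1`, `L(E^d,1)/Ω⁺ = 16` (engines 1 ∕ 2a agree). KERNEL: `Δ(W) = -230304689158540347` (primes 3, 13, 31),
the Kronecker symbols `(-23/p) = 1` at those primes and at `3`, `d ≡ 1 (mod 4)` squarefree, the field `ℚ(√-23)`, and the twist identity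
`Cd • W.quadraticTwist -23 = Wd` with `Cd = (u,r,s,t) = (1,-8,0,1/2)`, `Wd = ⟨0, -1, 1, -12009534, -281379052654⟩` (Tate ∕ PARI `ellminimalmodel`). ATTESTED: `L(E^d,1) ≠ 0`,
`#Ш_an(Wd) = 1`, `3 ∤ ∏c(E)`, global minimality. One curve; closes nothing. [cite: Miller2011LMS, Def. 1.1] -/
theorem cornerTwistWitnessAt_487227a1
    (hF : thm61_splitMultiplicative ∧ thm61_nonsplitMultiplicative ∧
      rank_eq_analyticRank_of_analyticRank_le_one ∧ WeierstrassCurve.hasEntireLFunction_rat ∧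
      nonempty_modularParametrizationData ∧
      (∀ (W : WeierstrassCurve ℚ) [W.IsElliptic] [W.IsGloballyMinimal] (p : ℕ) [Fact p.Prime],
        greenberg_stevens (W := W) (p := p)) ∧
      Kato2004.nonempty_iwasawaH1Data ∧ Kato2004.thm12_4 ∧
      Kato2004.exists_multDivisibilityInputs_nonsplit ∧ Kato2004.exists_multDivisibilityInputs_split ∧
      thm15_isTorsion_multiplicative_rat ∧
      Wuthrich2014.corollary18_padicLFunction_mem_iwasawaAlgebra_multiplicative ∧
      Kato2004.exists_multDivisibilityInputs_fine)
    (W : WeierstrassCurve ℚ) (hW : W = ⟨0, -1, 1, -22702, 23134308⟩) [W.IsElliptic] [W.IsGloballyMinimal]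
    (Wd : WeierstrassCurve ℚ) (hWd : Wd = ⟨0, -1, 1, -12009534, -281379052654⟩) [Wd.IsElliptic] [Wd.IsGloballyMinimal]
    (ht0 : ¬ 3 ∣ W.tamagawaProduct)
    (hLt : (W.quadraticTwist ((-23 : ℤ) : ℚ)).entireLFunction 1 ≠ 0) (hsha : shaAn Wd = ((1 : ℕ) : ℂ)) :
    CornerTwistWitnessAt W := by
  obtain ⟨hJs, hJn, hGZK, hmod, hpar, hGS, hne, h12, hns, hsp, h15, h18, hfine⟩ := hF
  exact cornerTwistWitnessAt_of_certifiedTwin hJs hJn hGZK hmod hpar hGS hne h12 hns hsp h15 h18 hfine W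
    (d := -23) (Δ₀ := -230304689158540347) (by decide) (Int.squarefree_natAbs.mp (by rw [Int.natAbs_neg]; exact (show Squarefree (23 : ℕ) from (by norm_num : Nat.Prime 23).prime.squarefree))) (by decide)
    (by subst hW; norm_num [WeierstrassCurve.Δ, WeierstrassCurve.b₂, WeierstrassCurve.b₄, WeierstrassCurve.b₆,
      WeierstrassCurve.b₈])
    (by
      intro p hp hpd
      have hn : (-230304689158540347 : ℤ).natAbs = 3 ^ 6 * 13 ^ 9 * 31 ^ 3 := by norm_num
      rw [hn] at hpd
      simp only [hp.dvd_mul, hp.prime.dvd_pow_iff_dvd, Nat.prime_dvd_prime_iff_eq hp (show Nat.Prime 3 by norm_num), Nat.prime_dvd_prime_iff_eq hp (show Nat.Prime 13 by norm_num), Nat.prime_dvd_prime_iff_eq hp (show Nat.Prime 31 by norm_num), ne_eq, OfNat.ofNat_ne_zero, not_false_eq_true] at hpd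
      rcases hpd with ((rfl | rfl) | rfl) <;> constructor <;> intro h <;> first | exact absurd h (by decide) | norm_num)
    (by norm_num)
    ht0 Wd ⟨1, (-8 : ℚ), 0, (1/2 : ℚ)⟩
    (by
      subst hW; subst hWd
      ext <;> simp only [variableChange_a₁, variableChange_a₂, variableChange_a₃, variableChange_a₄, variableChange_a₆,
        quadraticTwist_a₁, quadraticTwist_a₂, quadraticTwist_a₃, quadraticTwist_a₄, quadraticTwist_a₆,
        WeierstrassCurve.b₂, WeierstrassCurve.b₄, WeierstrassCurve.b₆] <;> push_cast <;> norm_num)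
    (by exact_mod_cast hLt) (shaAn_cert_of_eq_nat Wd (by norm_num) (by norm_num) hsha)

/-- **BC5 rung at Cremona `2535d1`** (N = 2535 = 3 · 5 · 13^2; image type `Ns` at `3`; Tamagawa cell `3 ∣ ∏c = 6`; μ_an(E^d) = 0 by OMS (kit j289586):
the EXACT odd Heegner twin `d = -131` — census row (kit j289043): `#Ш_an(E^d) = 1`, `∏_ℓ c_ℓ(E^d) = 12`,
`#E^d(ℚ)_tors = 1`, `L(E^d,1)/Ω⁺ = 12` (engines 1 ∕ 2a agree). KERNEL: `Δ(W) = -7414875` (primes 3, 5, 13),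
the Kronecker symbols `(-131/p) = 1` at those primes and at `3`, `d ≡ 1 (mod 4)` squarefree, the field `ℚ(√-131)`, and the twist identity
`Cd • W.quadraticTwist -131 = Wd` with `Cd = (u,r,s,t) = (1,-44,0,1/2)`, `Wd = ⟨0, -1, 1, 594915, -235893994⟩` (Tate ∕ PARI `ellminimalmodel`). ATTESTED: `L(E^d,1) ≠ 0`,
`#Ш_an(Wd) = 1`, the μ = 0 certificate at the twin (`hAn`), global minimality. One curve; closes nothing. [cite: Miller2011LMS, Def. 1.1] -/
theorem cornerTwistWitnessAt_2535d1
    (hF : thm61_splitMultiplicative ∧ thm61_nonsplitMultiplicative ∧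
      rank_eq_analyticRank_of_analyticRank_le_one ∧ WeierstrassCurve.hasEntireLFunction_rat ∧
      nonempty_modularParametrizationData ∧
      (∀ (W : WeierstrassCurve ℚ) [W.IsElliptic] [W.IsGloballyMinimal] (p : ℕ) [Fact p.Prime],
        greenberg_stevens (W := W) (p := p)) ∧
      Kato2004.nonempty_iwasawaH1Data ∧ Kato2004.thm12_4 ∧
      Kato2004.exists_multDivisibilityInputs_nonsplit ∧ Kato2004.exists_multDivisibilityInputs_split ∧
      thm15_isTorsion_multiplicative_rat ∧
      Wuthrich2014.corollary18_padicLFunction_mem_iwasawaAlgebra_multiplicative ∧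
      Kato2004.exists_multDivisibilityInputs_fine)
    (W : WeierstrassCurve ℚ) (hW : W = ⟨0, -1, 1, 35, 93⟩) [W.IsElliptic] [W.IsGloballyMinimal]
    (Wd : WeierstrassCurve ℚ) (hWd : Wd = ⟨0, -1, 1, 594915, -235893994⟩) [Wd.IsElliptic] [Wd.IsGloballyMinimal]
    (hAn : ∀ {N : ℕ} [NeZero N] (f : CuspForm (CongruenceSubgroup.Gamma0 N) 2), IsNewformOf Wd f →
      ∀ (ϖ : ℚ), (ϖ : ℝ) * Wd.realPeriodRat = plusPeriod f →
      ∀ (a : ℚ_[3]) (L : PowerSeries ℚ_[3]),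
        (Wd.HasSplitMultiplicativeReductionAtPrime 3 → a = 1) →
        (¬ Wd.HasSplitMultiplicativeReductionAtPrime 3 → a = -1) →
        IsMultPAdicLFunctionOf f 3 a L →
        ∃ n : ℕ, ‖PowerSeries.coeff n (PowerSeries.C ((ϖ : ℚ) : ℚ_[3]) * L)‖ = 1)
    (hLt : (W.quadraticTwist ((-131 : ℤ) : ℚ)).entireLFunction 1 ≠ 0) (hsha : shaAn Wd = ((1 : ℕ) : ℂ)) :
    CornerTwistWitnessAt W := by
  obtain ⟨hJs, hJn, hGZK, hmod, hpar, hGS, hne, h12, hns, hsp, h15, h18, hfine⟩ := hF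
  exact cornerTwistWitnessAt_of_certifiedTwin_of_muAn hJs hJn hGZK hmod hpar hGS hne h12 hns hsp h15 h18 hfine W
    (d := -131) (Δ₀ := -7414875) (by decide) (Int.squarefree_natAbs.mp (by rw [Int.natAbs_neg]; exact (show Squarefree (131 : ℕ) from (by norm_num : Nat.Prime 131).prime.squarefree))) (by decide)
    (by subst hW; norm_num [WeierstrassCurve.Δ, WeierstrassCurve.b₂, WeierstrassCurve.b₄, WeierstrassCurve.b₆,
      WeierstrassCurve.b₈])
    (by
      intro p hp hpd
      have hn : (-7414875 : ℤ).natAbs = 3 ^ 3 * 5 ^ 3 * 13 ^ 3 := by norm_num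
      rw [hn] at hpd
      simp only [hp.dvd_mul, hp.prime.dvd_pow_iff_dvd, Nat.prime_dvd_prime_iff_eq hp (show Nat.Prime 3 by norm_num), Nat.prime_dvd_prime_iff_eq hp (show Nat.Prime 5 by norm_num), Nat.prime_dvd_prime_iff_eq hp (show Nat.Prime 13 by norm_num), ne_eq, OfNat.ofNat_ne_zero, not_false_eq_true] at hpd
      rcases hpd with ((rfl | rfl) | rfl) <;> constructor <;> intro h <;> first | exact absurd h (by decide) | norm_num)
    (by norm_num)
    Wd ⟨1, (-44 : ℚ), 0, (1/2 : ℚ)⟩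
    (by
      subst hW; subst hWd
      ext <;> simp only [variableChange_a₁, variableChange_a₂, variableChange_a₃, variableChange_a₄, variableChange_a₆,
        quadraticTwist_a₁, quadraticTwist_a₂, quadraticTwist_a₃, quadraticTwist_a₄, quadraticTwist_a₆,
        WeierstrassCurve.b₂, WeierstrassCurve.b₄, WeierstrassCurve.b₆] <;> push_cast <;> norm_num)
    (by exact_mod_cast hLt) (shaAn_cert_of_eq_nat Wd (by norm_num) (by norm_num) hsha) hAn

/-- **BC5 rung at Cremona `3840k1`** (N = 3840 = 2^8 · 3 · 5; image type `Ns` at `3`; Tamagawa cell `3 ∣ ∏c = 36`; μ_an(E^d) = 0 by OMS (kit j289586):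
the EXACT odd Heegner twin `d = -71` — census row (kit j289043): `#Ш_an(E^d) = 1`, `∏_ℓ c_ℓ(E^d) = 144`,
`#E^d(ℚ)_tors = 2`, `L(E^d,1)/Ω⁺ = 36` (engines 1 ∕ 2a agree). KERNEL: `Δ(W) = 46656000` (primes 2, 3, 5),
the Kronecker symbols `(-71/p) = 1` at those primes and at `3`, `d ≡ 1 (mod 4)` squarefree, the field `ℚ(√-71)`, and the twist identity
`Cd • W.quadraticTwist -71 = Wd` with `Cd = (u,r,s,t) = (1,24,0,0)`, `Wd = ⟨0, 1, 0, -1589595, -762906807⟩` (Tate ∕ PARI `ellminimalmodel`). ATTESTED: `L(E^d,1) ≠ 0`,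
`#Ш_an(Wd) = 1`, the μ = 0 certificate at the twin (`hAn`), global minimality. One curve; closes nothing. [cite: Miller2011LMS, Def. 1.1] -/
theorem cornerTwistWitnessAt_3840k1
    (hF : thm61_splitMultiplicative ∧ thm61_nonsplitMultiplicative ∧
      rank_eq_analyticRank_of_analyticRank_le_one ∧ WeierstrassCurve.hasEntireLFunction_rat ∧
      nonempty_modularParametrizationData ∧
      (∀ (W : WeierstrassCurve ℚ) [W.IsElliptic] [W.IsGloballyMinimal] (p : ℕ) [Fact p.Prime],
        greenberg_stevens (W := W) (p := p)) ∧
      Kato2004.nonempty_iwasawaH1Data ∧ Kato2004.thm12_4 ∧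
      Kato2004.exists_multDivisibilityInputs_nonsplit ∧ Kato2004.exists_multDivisibilityInputs_split ∧
      thm15_isTorsion_multiplicative_rat ∧
      Wuthrich2014.corollary18_padicLFunction_mem_iwasawaAlgebra_multiplicative ∧
      Kato2004.exists_multDivisibilityInputs_fine)
    (W : WeierstrassCurve ℚ) (hW : W = ⟨0, 1, 0, -315, 2025⟩) [W.IsElliptic] [W.IsGloballyMinimal]
    (Wd : WeierstrassCurve ℚ) (hWd : Wd = ⟨0, 1, 0, -1589595, -762906807⟩) [Wd.IsElliptic] [Wd.IsGloballyMinimal]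
    (hAn : ∀ {N : ℕ} [NeZero N] (f : CuspForm (CongruenceSubgroup.Gamma0 N) 2), IsNewformOf Wd f →
      ∀ (ϖ : ℚ), (ϖ : ℝ) * Wd.realPeriodRat = plusPeriod f →
      ∀ (a : ℚ_[3]) (L : PowerSeries ℚ_[3]),
        (Wd.HasSplitMultiplicativeReductionAtPrime 3 → a = 1) →
        (¬ Wd.HasSplitMultiplicativeReductionAtPrime 3 → a = -1) →
        IsMultPAdicLFunctionOf f 3 a L →
        ∃ n : ℕ, ‖PowerSeries.coeff n (PowerSeries.C ((ϖ : ℚ) : ℚ_[3]) * L)‖ = 1)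
    (hLt : (W.quadraticTwist ((-71 : ℤ) : ℚ)).entireLFunction 1 ≠ 0) (hsha : shaAn Wd = ((1 : ℕ) : ℂ)) :
    CornerTwistWitnessAt W := by
  obtain ⟨hJs, hJn, hGZK, hmod, hpar, hGS, hne, h12, hns, hsp, h15, h18, hfine⟩ := hF
  exact cornerTwistWitnessAt_of_certifiedTwin_of_muAn hJs hJn hGZK hmod hpar hGS hne h12 hns hsp h15 h18 hfine W
    (d := -71) (Δ₀ := 46656000) (by decide) (Int.squarefree_natAbs.mp (by rw [Int.natAbs_neg]; exact (show Squarefree (71 : ℕ) from (by norm_num : Nat.Prime 71).prime.squarefree))) (by decide)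
    (by subst hW; norm_num [WeierstrassCurve.Δ, WeierstrassCurve.b₂, WeierstrassCurve.b₄, WeierstrassCurve.b₆,
      WeierstrassCurve.b₈])
    (by
      intro p hp hpd
      have hn : (46656000 : ℤ).natAbs = 2 ^ 9 * 3 ^ 6 * 5 ^ 3 := by norm_num
      rw [hn] at hpd
      simp only [hp.dvd_mul, hp.prime.dvd_pow_iff_dvd, Nat.prime_dvd_prime_iff_eq hp (show Nat.Prime 2 by norm_num), Nat.prime_dvd_prime_iff_eq hp (show Nat.Prime 3 by norm_num), Nat.prime_dvd_prime_iff_eq hp (show Nat.Prime 5 by norm_num), ne_eq, OfNat.ofNat_ne_zero, not_false_eq_true] at hpd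
      rcases hpd with ((rfl | rfl) | rfl) <;> constructor <;> intro h <;> first | exact absurd h (by decide) | norm_num)
    (by norm_num)
    Wd ⟨1, 24, 0, 0⟩
    (by
      subst hW; subst hWd
      ext <;> simp only [variableChange_a₁, variableChange_a₂, variableChange_a₃, variableChange_a₄, variableChange_a₆,
        quadraticTwist_a₁, quadraticTwist_a₂, quadraticTwist_a₃, quadraticTwist_a₄, quadraticTwist_a₆,
        WeierstrassCurve.b₂, WeierstrassCurve.b₄, WeierstrassCurve.b₆] <;> push_cast <;> norm_num)
    (by exact_mod_cast hLt) (shaAn_cert_of_eq_nat Wd (by norm_num) (by norm_num) hsha) hAn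


end Summit.BirchSwinnertonDyer.BirchSwinnertonDyer.Theorems.CornerTwistWitness
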